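import Literature.NumberTheory.QuadraticFields.ThreeTorsionMeanProgressionCountPos
import Mathlib.Analysis.SpecialFunctions.Pow.Asymptotics
import HarnessLib

/-!
# Means of `#Cl₃` in progressions from Taniguchi–Thorne, Thm 6, and the discriminant counts

Theorems-only companion of `ThreeTorsionMean.lean`. With the fundamental-discriminant counts in
progressions `#{D : D ≡ a (mod m)} = (3/(π² m)) Π_{p ∣ m} (1 - p⁻²)⁻¹ X + O(√X)` PROVED in
`ThreeTorsionMeanProgressionCount(Pos).lean`, the named fact `tt_threeTorsion_sum_progression`
(Taniguchi–Thorne 2013, Thm 6) about SUMS of `#Cl₃(D)` over `D ≡ a (mod m)` yields the MEANS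
consumers use (the `m = 1` analogue `bst_threeTorsion_mean_of_btt_threeTorsion_sum` is in
`ThreeTorsionMeanProofs.lean`):

* `tendsto_div_of_two_term_and_sqrt_asymptotics` — bookkeeping: `S(X) = A X + K X^{5/6} + O(X^θ)`
  (`θ < 1`) and `N(X) = B X + O(√X)`, `B ≠ 0`, give `S(X)/N(X) → A/B`;
* `tt_threeTorsion_sum_progression.tendsto_mean_neg/pos` — Taniguchi–Thorne Thm 6 implies that
  the mean of `#Cl₃(D)` over `D ≡ a (mod m)`, `(6a, m) = 1`, tends to `2` (`D < 0`) and `4/3`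
  (`D > 0`), the same values as without the congruence (Davenport–Heilbronn).

## References
* T. Taniguchi, F. Thorne, Duke Math. J. 162 (2013), Thm 6 [TaniguchiThorne2013].
-/

noncomputable section

open Finset Filter
open scoped Topology

namespace Literature.NumberTheory.QuadraticFields

/-! ### Bookkeeping: ratio of a two-term asymptotic and a linear count -/

/-- A function `F` with `|F(X) - A X| ≤ c₁ X^{θ₁} + c₂ X^{θ₂}` for `X ≥ 1`, where `θ₁, θ₂ < 1`,
satisfies `F(X)/X → A`. [folklore] -/
theorem tendsto_div_natCast_of_abs_sub_le {F : ℕ → ℝ} {A c₁ c₂ θ₁ θ₂ : ℝ} (hθ₁ : θ₁ < 1)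
    (hθ₂ : θ₂ < 1)
    (hF : ∀ X : ℕ, 1 ≤ X → |F X - A * X| ≤ c₁ * (X : ℝ) ^ θ₁ + c₂ * (X : ℝ) ^ θ₂) :
    Tendsto (fun X : ℕ => F X / X) atTop (𝓝 A) := by
  rw [← tendsto_sub_nhds_zero_iff]
  have hbound : ∀ᶠ X : ℕ in atTop, |F X / X - A| ≤
      |c₁| * (X : ℝ) ^ (-(1 - θ₁)) + |c₂| * (X : ℝ) ^ (-(1 - θ₂)) := by
    filter_upwards [eventually_ge_atTop 1] with X hX
    have hX0 : (0 : ℝ) < X := by exact_mod_cast hX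
    have h1 : F X / X - A = (F X - A * X) / X := by field_simp
    rw [h1, abs_div, abs_of_pos hX0, div_le_iff₀ hX0]
    refine (hF X hX).trans ?_
    have e₁ : (X : ℝ) ^ (-(1 - θ₁)) * X = (X : ℝ) ^ θ₁ := by
      rw [← Real.rpow_add_one hX0.ne']; ring_nf
    have e₂ : (X : ℝ) ^ (-(1 - θ₂)) * X = (X : ℝ) ^ θ₂ := by
      rw [← Real.rpow_add_one hX0.ne']; ring_nf
    rw [add_mul, mul_assoc, e₁, mul_assoc, e₂]
    gcongr
    · exact le_abs_self c₁
    · exact le_abs_self c₂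
  have hlim : Tendsto (fun X : ℕ => |c₁| * (X : ℝ) ^ (-(1 - θ₁)) + |c₂| * (X : ℝ) ^ (-(1 - θ₂)))
      atTop (𝓝 0) := by
    have h1 := ((tendsto_rpow_neg_atTop (y := 1 - θ₁) (by linarith)).comp
      tendsto_natCast_atTop_atTop).const_mul |c₁|
    have h2 := ((tendsto_rpow_neg_atTop (y := 1 - θ₂) (by linarith)).comp
      tendsto_natCast_atTop_atTop).const_mul |c₂|
    simpa using h1.add h2
  rw [tendsto_zero_iff_norm_tendsto_zero]
  exact squeeze_zero' (Eventually.of_forall fun X => norm_nonneg _)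
    (by simpa only [Real.norm_eq_abs] using hbound) hlim

/-- **Ratio bookkeeping.** If `|S(X) - A X - K X^{5/6}| ≤ C X^θ` (`θ < 1`) and
`|N(X) - B X| ≤ C' √X` for `X ≥ 1`, with `B ≠ 0`, then `S(X)/N(X) → A/B`. [folklore] -/
theorem tendsto_div_of_two_term_and_sqrt_asymptotics {S N : ℕ → ℝ} {A B K C C' θ : ℝ} (hθ : θ < 1)
    (hB : B ≠ 0)
    (hS : ∀ X : ℕ, 1 ≤ X → |S X - A * X - K * (X : ℝ) ^ ((5 : ℝ) / 6)| ≤ C * (X : ℝ) ^ θ)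
    (hN : ∀ X : ℕ, 1 ≤ X → |N X - B * X| ≤ C' * Real.sqrt X) :
    Tendsto (fun X : ℕ => S X / N X) atTop (𝓝 (A / B)) := by
  have hS' : Tendsto (fun X : ℕ => S X / X) atTop (𝓝 A) := by
    refine tendsto_div_natCast_of_abs_sub_le (c₁ := |K|) (θ₁ := 5 / 6) (c₂ := C) (θ₂ := θ)
      (by norm_num) hθ fun X hX => ?_
    have h := hS X hX
    have htri : |S X - A * X| ≤ |S X - A * X - K * (X : ℝ) ^ ((5 : ℝ) / 6)|
        + |K * (X : ℝ) ^ ((5 : ℝ) / 6)| := by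
      have := abs_add_le (S X - A * X - K * (X : ℝ) ^ ((5 : ℝ) / 6)) (K * (X : ℝ) ^ ((5 : ℝ) / 6))
      rwa [sub_add_cancel] at this
    rw [abs_mul, abs_of_nonneg (Real.rpow_nonneg (Nat.cast_nonneg X) _)] at htri
    linarith
  have hN' : Tendsto (fun X : ℕ => N X / X) atTop (𝓝 B) := by
    refine tendsto_div_natCast_of_abs_sub_le (c₁ := C') (θ₁ := 1 / 2) (c₂ := 0) (θ₂ := 0)
      (by norm_num) (by norm_num) fun X hX => ?_
    have h := hN X hX
    rw [Real.sqrt_eq_rpow] at h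
    simpa using h
  have hdiv := hS'.div hN' hB
  refine hdiv.congr' ?_
  filter_upwards [eventually_ge_atTop 1] with X hX
  have hX0 : (X : ℝ) ≠ 0 := by exact_mod_cast (show X ≠ 0 by omega)
  exact div_div_div_cancel_right₀ hX0 (S X) (N X)

/-! ### Means in progressions from Taniguchi–Thorne, Thm 6 -/

/-- **Mean `2` in progressions, imaginary side**: under `tt_threeTorsion_sum_progression`, for
`(6a, m) = 1` the mean of `#Cl₃(D)` over `-X < D < 0`, `D ≡ a (mod m)` tends to `2`.
[cite: TaniguchiThorne2013, Theorem 6] -/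
theorem tt_threeTorsion_sum_progression.tendsto_mean_neg (h : tt_threeTorsion_sum_progression)
    {m : ℕ} {a : ℤ} (hm : 1 ≤ m) (ha : Int.gcd (6 * a) m = 1) :
    Tendsto (fun X : ℕ =>
      (∑ D ∈ (negFundDiscrs X).filter (fun D => D ≡ a [ZMOD m]), (quadFieldThreeTorsion D : ℝ)) /
        ((((negFundDiscrs X).filter (fun D => D ≡ a [ZMOD m])).card : ℕ) : ℝ)) atTop (𝓝 2) := by
  obtain ⟨K, hK⟩ := (h m a hm ha).1
  obtain ⟨C, hC⟩ := hK (1 / 46) (by norm_num)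
  set P := ∏ p ∈ m.primeFactors, (1 - 1 / (p : ℝ) ^ 2)⁻¹ with hP
  have hPpos : 0 < P := by
    refine Finset.prod_pos fun p hp => inv_pos.2 ?_
    have hp2 : (2 : ℝ) ≤ p := by exact_mod_cast (Nat.prime_of_mem_primeFactors hp).two_le
    have : 1 / (p : ℝ) ^ 2 ≤ 1 / 4 := one_div_le_one_div_of_le (by norm_num) (by nlinarith)
    linarith
  have hm0 : (0 : ℝ) < m := by exact_mod_cast hm
  have hB : 3 / (Real.pi ^ 2 * m) * P ≠ 0 := by positivity
  have hlim := tendsto_div_of_two_term_and_sqrt_asymptotics (A := 6 / (Real.pi ^ 2 * m) * P)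
    (B := 3 / (Real.pi ^ 2 * m) * P) (K := K) (C := C) (C' := 18) (θ := 18 / 23 + 1 / 46)
    (by norm_num) hB (fun X hX => hC X hX)
    (fun X hX => abs_card_negFundDiscrs_filter_modEq_sub_le_of_gcd_six_mul ha hX)
  have hval : 6 / (Real.pi ^ 2 * m) * P / (3 / (Real.pi ^ 2 * m) * P) = 2 := by
    field_simp; norm_num
  rwa [hval] at hlim

/-- **Mean `4/3` in progressions, real side**: under `tt_threeTorsion_sum_progression`, for
`(6a, m) = 1` the mean of `#Cl₃(D)` over `0 < D < X`, `D ≡ a (mod m)` tends to `4/3`.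
[cite: TaniguchiThorne2013, Theorem 6] -/
theorem tt_threeTorsion_sum_progression.tendsto_mean_pos (h : tt_threeTorsion_sum_progression)
    {m : ℕ} {a : ℤ} (hm : 1 ≤ m) (ha : Int.gcd (6 * a) m = 1) :
    Tendsto (fun X : ℕ =>
      (∑ D ∈ (posFundDiscrs X).filter (fun D => D ≡ a [ZMOD m]), (quadFieldThreeTorsion D : ℝ)) /
        ((((posFundDiscrs X).filter (fun D => D ≡ a [ZMOD m])).card : ℕ) : ℝ)) atTop
      (𝓝 (4 / 3)) := by
  obtain ⟨K, hK⟩ := (h m a hm ha).2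
  obtain ⟨C, hC⟩ := hK (1 / 46) (by norm_num)
  set P := ∏ p ∈ m.primeFactors, (1 - 1 / (p : ℝ) ^ 2)⁻¹ with hP
  have hPpos : 0 < P := by
    refine Finset.prod_pos fun p hp => inv_pos.2 ?_
    have hp2 : (2 : ℝ) ≤ p := by exact_mod_cast (Nat.prime_of_mem_primeFactors hp).two_le
    have : 1 / (p : ℝ) ^ 2 ≤ 1 / 4 := one_div_le_one_div_of_le (by norm_num) (by nlinarith)
    linarith
  have hm0 : (0 : ℝ) < m := by exact_mod_cast hm
  have hB : 3 / (Real.pi ^ 2 * m) * P ≠ 0 := by positivity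
  have hlim := tendsto_div_of_two_term_and_sqrt_asymptotics (A := 4 / (Real.pi ^ 2 * m) * P)
    (B := 3 / (Real.pi ^ 2 * m) * P) (K := K) (C := C) (C' := 18) (θ := 18 / 23 + 1 / 46)
    (by norm_num) hB (fun X hX => hC X hX)
    (fun X hX => abs_card_posFundDiscrs_filter_modEq_sub_le_of_gcd_six_mul ha hX)
  have hval : 4 / (Real.pi ^ 2 * m) * P / (3 / (Real.pi ^ 2 * m) * P) = 4 / 3 := by
    field_simp
  rwa [hval] at hlim

end Literature.NumberTheory.QuadraticFields

end
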